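import Summits.CriticalPhenomena.CardyFormulaZ2.Theorems.CardyComplexConeParafermionToSLESixFamiliesDiamondDefsR5
import Summits.CriticalPhenomena.CardyFormulaZ2.Theorems.CardyComplexConeParafermionToSLESixFamiliesDiamondClassMoreraRect
import Summits.CriticalPhenomena.CardyFormulaZ2.Theorems.CardyComplexConeParafermionToSLESixFamiliesDiamondClassCells
import Summits.CriticalPhenomena.CardyFormulaZ2.Theorems.CardyComplexConeParafermionToSLESixFamiliesDiamondClassModesFamily
import HarnessLib

/-!
# Line `potential-darboux-picard-diamond`, conjunct (b′) of S3: the class structure of CONTINUOUS potential limits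

Work file of the conditional stub `closedClass_of_edgeCoherence_edgePrecompact : EdgeCoherence → EdgePrecompact → ClosedClass`
of crux `ParafermionToSLESixFamilies` (stmt-CriticalPhenomena-11389), line `potential-darboux-picard-diamond`.

**The registered statement is mis-stated**: `IsPotentialLimit D Λ u G` constrains `G` only at the countably many cell
centres `ctr (u k) f`, so every potential limit can be modified off that set into a discontinuous potential limit
(`isPotentialLimit_congr_off_centres`, `not_isPotentialLimit_of_closedClass`: `ClosedClass` as typed implies that NO
potential limit exists along any family, against the landed `exists_subseq_potentialLimit`). **The corrected statement**
adds the hypothesis `ContinuousOn G D.carrier` (which the only consumer, `potentialConformalLimit_of_identify`, has as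
`ContinuousOn G (closure D.carrier)`), and is PROVED here from `EdgeCoherence` alone:
`closedClass_continuous_of_edgeCoherence`. Proof: the landed toolkit of this line — interior vertices/cells
(`…DiamondClassCells`), the vertex defects of the face potential of an exact pair are `u_k^{2/3} ×` the corner defects
(`vtxDefect_of_exactPair`), mode selection from `EdgeCoherence` (`pairedSmall_of_edgeCoherence`: one of the two corner
defects is `o(δ^{1/3})` in horizontal pairs), and the discrete Morera theorem `differentiableOn_of_faceLimit` applied to
`G` (holomorphic alternative) or to `conj ∘ G` (antiholomorphic alternative).
-/

noncomputable section

namespace Summit.CriticalPhenomena.CardyFormulaZ2.Cruxes.ParafermionToSLESixFamilies.PotentialDarbouxPicardDiamond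

open scoped Topology
open Filter Set Metric Complex
open Literature.Probability Literature.Probability.LatticeModels Literature.Probability.Percolation
open Literature.Probability.LatticeModels.DiscreteDobrushin
open Literature.Probability.RandomPlanarGeometry
open Summit.CriticalPhenomena.CardyFormulaZ2.Cruxes.ParafermionToSLESixFamilies.IicTraceFluxPairing (IsFamily)
open Summit.CriticalPhenomena.CardyFormulaZ2.Theses.CardyComplexCone (EdgeCoherence EdgePrecompact)
open Summit.CriticalPhenomena.CardyFormulaZ2.Cruxes.EdgePrecompact.QkzStripBoundaryArm (cornerObs)
open Summit.CriticalPhenomena.CardyFormulaZ2.Cruxes.CoherentMorera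
open Summit.CriticalPhenomena.CardyFormulaZ2.Cruxes.CoherentMorera.FinitaryGreenPairing (e0 e1 Guards)
open Summit.CriticalPhenomena.CardyFormulaZ2.Cruxes.CoherentMorera.FinitaryGreenPairing.ModeSelection (isCorner_site)

/-! ## The vertex defects of the face potential of an exact pair -/

/-- **Vertex defects of an exact pair are corner defects.** If `Ψ(NE) = Φ v − E₀`, `Ψ(NW) = Φ v − i E₁`,
`Ψ(SE) = Φ v + i E₃` then the holomorphic vertex defect of `c Ψ` at `v` is `c ((1 − i)E₀ − E₁ + iE₃)` and that of
`conj (c Ψ)` is the conjugate of `c ((1 + i)E₀ + E₁ + iE₃)` (`Φ v` drops out: the coefficients sum to zero). -/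
theorem vtxDefect_of_faces {Ψ : Site 2 → ℂ} {v : Site 2} {Φv E₀ E₁ E₃ : ℂ} (c : ℂ) (h0 : Ψ v = Φv - E₀)
    (h1 : Ψ (v - Pi.single 0 1) = Φv - I * E₁) (h3 : Ψ (v - Pi.single 1 1) = Φv + I * E₃) :
    vtxDefect (fun f => c * Ψ f) v = c * ((1 - I) * E₀ - E₁ + I * E₃) ∧
      vtxDefect (fun f => (starRingEnd ℂ) (c * Ψ f)) v = (starRingEnd ℂ) (c * ((1 + I) * E₀ + E₁ + I * E₃)) := by
  constructor
  · simp only [vtxDefect, h0, h1, h3]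
    linear_combination (c * E₁) * I_sq
  · simp only [vtxDefect, h0, h1, h3, map_mul, map_sub, map_add, Complex.conj_I, map_one]
    linear_combination (-(starRingEnd ℂ) c * (starRingEnd ℂ) E₁) * I_sq

/-- **The vertex defects of the renormalised face potentials along a diamond family.** For exact pairs `(Φ_k, Ψ_k)` of
the data `Λ (u k)` and `H_k = u_k^{2/3} Ψ_k`: on every compact `K ⊆ D`, eventually in `k`, at every vertex `v` whose mesh
point is within `u_k` of `K`, the holomorphic vertex defect of `H_k` is `u_k^{2/3} · holDefect` of the corner observable
and that of `conj H_k` is the conjugate of `u_k^{2/3} · antiDefect`. -/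
theorem eventually_vtxDefect_eq (D : DobrushinDomain) (hD : IsMarkedDiamond D) (Λ : ℝ → DiscreteDobrushin)
    (hΛ : IsFamily D Λ) {u : ℕ → ℝ} (hu : ∀ k, 0 < u k) (hu0 : Tendsto u atTop (𝓝 0))
    {P : ℕ → (Site 2 → ℂ) × (Site 2 → ℂ)} (hP : ∀ k, IsExactPair (Λ (u k)) (u k) (P k).1 (P k).2)
    {K : Set ℂ} (hK : IsCompact K) (hKD : K ⊆ D.carrier) :
    ∀ᶠ k in atTop, ∀ v : Site 2, (∃ p ∈ K, dist (meshPoint (u k) v) p ≤ u k) →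
      vtxDefect (fun f => ((((u k) ^ ((2:ℝ) / 3) : ℝ)) : ℂ) * (P k).2 f) v =
        ((((u k) ^ ((2:ℝ) / 3) : ℝ)) : ℂ) * holDefect (FinitaryGreenPairing.cornerObs Λ (u k)) v ∧
      vtxDefect (fun f => (starRingEnd ℂ) (((((u k) ^ ((2:ℝ) / 3) : ℝ)) : ℂ) * (P k).2 f)) v =
        (starRingEnd ℂ) (((((u k) ^ ((2:ℝ) / 3) : ℝ)) : ℂ) * antiDefect (FinitaryGreenPairing.cornerObs Λ (u k)) v) := by
  filter_upwards [eventually_atTop_of_eventually_nhdsGT hu hu0 (eventually_interior_vertex D hD Λ hΛ hK hKD)]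
    with k hk v hv
  obtain ⟨hA, hB, hfaces⟩ := hk v hv
  obtain ⟨c0, c1, -, c3⟩ := isCorner_site v
  obtain ⟨e0', e1', e3'⟩ := exactPair_faces (hP k) hA hB (hfaces _ c0).1 (hfaces _ c1).1 (hfaces _ c3).1
  exact vtxDefect_of_faces _ e0' e1' e3'

/-! ## The corrected conjunct (b′): continuous potential limits are holomorphic or antiholomorphic -/

/-- **S3 (b′) for CONTINUOUS potential limits, from `EdgeCoherence`.** Along every admissible family of a marked
diamond and every sequence of positive meshes `u_k → 0`, every potential limit `G` (`IsPotentialLimit`) which is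
continuous on the carrier is holomorphic on the carrier or has `conj ∘ G` holomorphic there. (`EdgePrecompact` is not
needed: the corner observable enters only through `o(δ^{1/3})` defect bounds.) -/
theorem closedClass_continuous_of_edgeCoherence : Summit.CriticalPhenomena.CardyFormulaZ2.Theses.CardyComplexCone.EdgeCoherence → ∀ (D : DobrushinDomain), IsMarkedDiamond D → ∀ (Λ : ℝ → DiscreteDobrushin), IsFamily D Λ → ∀ u : ℕ → ℝ, (∀ k, 0 < u k) → Tendsto u atTop (𝓝 0) → ∀ G : ℂ → ℂ, ContinuousOn G D.carrier → IsPotentialLimit D Λ u G → DifferentiableOn ℂ G D.carrier ∨ DifferentiableOn ℂ (fun z => (starRingEnd ℂ) (G z)) D.carrier := by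
  intro hEC D hD Λ hΛ u hu hu0 G hG hPL
  obtain ⟨P, z, hP, hlimP⟩ := hPL
  have hGd : Guards D Λ := ⟨hΛ.1, hΛ.2.1, hΛ.2.2.2.2.2⟩
  set c : ℕ → ℂ := fun k => ((((u k) ^ ((2:ℝ) / 3) : ℝ)) : ℂ) with hc
  have hcn : ∀ k, ‖c k‖ = (u k) ^ ((2:ℝ) / 3) := fun k => by
    rw [hc]; simp only [Complex.norm_real, Real.norm_eq_abs, abs_of_nonneg (Real.rpow_nonneg (hu k).le _)]
  have hcu : ∀ k, (u k) ^ ((2:ℝ) / 3) * (u k) ^ ((1:ℝ) / 3) = u k := fun k => by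
    rw [← Real.rpow_add (hu k)]; norm_num
  -- convergence at ALL faces over compacts (every such face is eventually a cell)
  have hlim : ∀ K : Set ℂ, IsCompact K → K ⊆ D.carrier → ∀ ε > (0:ℝ), ∀ᶠ k in atTop, ∀ f : Site 2,
      ctr (u k) f ∈ K → ‖c k * (P k).2 f - z k - G (ctr (u k) f)‖ ≤ ε := by
    intro K hK hKD ε hε
    filter_upwards [hlimP K hK hKD ε hε,
      eventually_atTop_of_eventually_nhdsGT hu hu0 (eventually_isCell_of_ctr_mem D hD Λ hΛ hK hKD)] with k h1 h2 f hf
    exact h1 f (h2 f hf) hf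
  have hlim' : ∀ K : Set ℂ, IsCompact K → K ⊆ D.carrier → ∀ ε > (0:ℝ), ∀ᶠ k in atTop, ∀ f : Site 2,
      ctr (u k) f ∈ K → ‖(starRingEnd ℂ) (c k * (P k).2 f) - (starRingEnd ℂ) (z k) -
        (starRingEnd ℂ) (G (ctr (u k) f))‖ ≤ ε := by
    intro K hK hKD ε hε
    filter_upwards [hlim K hK hKD ε hε] with k hk f hf
    rw [← map_sub, ← map_sub, Complex.norm_conj]; exact hk f hf
  rcases pairedSmall_of_edgeCoherence hEC with hhol | hanti
  · -- holomorphic alternative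
    left
    refine differentiableOn_of_faceLimit D.isOpen hu hu0 hG hlim fun K hK hKD ε hε => ?_
    filter_upwards [eventually_vtxDefect_eq D hD Λ hΛ hu hu0 hP hK hKD,
      eventually_atTop_of_eventually_nhdsGT hu hu0 (hhol D Λ hGd K hK hKD ε hε)] with k hk hsm v hv
    have hv' : ∃ p ∈ K, dist (meshPoint (u k) (v + Pi.single 0 1)) p ≤ u k :=
      ⟨_, hv, by rw [FinitaryGreenPairing.meshPoint_add_e0, dist_eq_norm, add_sub_cancel_left, Complex.norm_real,
        Real.norm_of_nonneg (hu k).le]⟩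
    rw [(hk v ⟨_, hv, by rw [dist_self]; exact (hu k).le⟩).1, (hk _ hv').1, ← mul_add, norm_mul, hcn]
    calc (u k) ^ ((2:ℝ) / 3) * ‖holDefect (FinitaryGreenPairing.cornerObs Λ (u k)) v +
          holDefect (FinitaryGreenPairing.cornerObs Λ (u k)) (v + Pi.single 0 1)‖
        ≤ (u k) ^ ((2:ℝ) / 3) * (ε * (u k) ^ ((1:ℝ) / 3)) :=
          mul_le_mul_of_nonneg_left (hsm v hv) (Real.rpow_nonneg (hu k).le _)
      _ = ε * ((u k) ^ ((2:ℝ) / 3) * (u k) ^ ((1:ℝ) / 3)) := by ring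
      _ = ε * u k := by rw [hcu k]
  · -- antiholomorphic alternative: `conj ∘ G` is the face-potential limit of `conj H_k`
    right
    refine differentiableOn_of_faceLimit D.isOpen hu hu0 (Complex.continuous_conj.comp_continuousOn hG)
      (H := fun k f => (starRingEnd ℂ) (c k * (P k).2 f)) (z := fun k => (starRingEnd ℂ) (z k)) hlim'
      fun K hK hKD ε hε => ?_
    filter_upwards [eventually_vtxDefect_eq D hD Λ hΛ hu hu0 hP hK hKD,
      eventually_atTop_of_eventually_nhdsGT hu hu0 (hanti D Λ hGd K hK hKD ε hε)] with k hk hsm v hv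
    have hv' : ∃ p ∈ K, dist (meshPoint (u k) (v + Pi.single 0 1)) p ≤ u k :=
      ⟨_, hv, by rw [FinitaryGreenPairing.meshPoint_add_e0, dist_eq_norm, add_sub_cancel_left, Complex.norm_real,
        Real.norm_of_nonneg (hu k).le]⟩
    rw [(hk v ⟨_, hv, by rw [dist_self]; exact (hu k).le⟩).2, (hk _ hv').2, ← map_add, Complex.norm_conj,
      ← mul_add, norm_mul, hcn]
    calc (u k) ^ ((2:ℝ) / 3) * ‖antiDefect (FinitaryGreenPairing.cornerObs Λ (u k)) v +
          antiDefect (FinitaryGreenPairing.cornerObs Λ (u k)) (v + Pi.single 0 1)‖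
        ≤ (u k) ^ ((2:ℝ) / 3) * (ε * (u k) ^ ((1:ℝ) / 3)) :=
          mul_le_mul_of_nonneg_left (hsm v hv) (Real.rpow_nonneg (hu k).le _)
      _ = ε * ((u k) ^ ((2:ℝ) / 3) * (u k) ^ ((1:ℝ) / 3)) := by ring
      _ = ε * u k := by rw [hcu k]

/-! ## Why the registered statement is mis-stated: potential limits are unconstrained off the cell centres -/

/-- A potential limit stays one after an arbitrary modification off the cell centres. -/
theorem isPotentialLimit_congr_off_centres {D : DobrushinDomain} {Λ : ℝ → DiscreteDobrushin} {u : ℕ → ℝ}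
    {G G' : ℂ → ℂ} (h : IsPotentialLimit D Λ u G) (hG : ∀ (k : ℕ) (f : Site 2), G' (ctr (u k) f) = G (ctr (u k) f)) :
    IsPotentialLimit D Λ u G' := by
  obtain ⟨P, z, hP, hl⟩ := h
  refine ⟨P, z, hP, fun K hK hKD ε hε => ?_⟩
  filter_upwards [hl K hK hKD ε hε] with k hk f hf hfK
  rw [hG]; exact hk f hf hfK

/-- **`ClosedClass` as typed leaves no potential limit at all.** If conjunct (b′) held as registered (no continuity
hypothesis on `G`), then along every admissible family of every marked diamond and every positive null sequence NO
function would be a potential limit: modify a potential limit at one point of the carrier that is not a cell centre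
(there are uncountably many) — both the original and the modified function would be (anti)holomorphic, hence continuous,
on the carrier and agree off one point, a contradiction. Since the landed `exists_subseq_potentialLimit` produces potential
limits from (E) and the collar (a), S3 as typed is inconsistent with the existence of an admissible diamond family. -/
theorem not_isPotentialLimit_of_closedClass (h : ClosedClass) (D : DobrushinDomain) (hD : IsMarkedDiamond D)
    (Λ : ℝ → DiscreteDobrushin) (hΛ : IsFamily D Λ) (u : ℕ → ℝ) (hu : ∀ k, 0 < u k) (hu0 : Tendsto u atTop (𝓝 0))
    (G : ℂ → ℂ) : ¬ IsPotentialLimit D Λ u G := by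
  intro hG
  -- a point of the carrier which is not a cell centre
  set C : Set ℂ := ⋃ k : ℕ, Set.range (fun f : Site 2 => ctr (u k) f) with hC
  have hCc : C.Countable := countable_iUnion fun k => countable_range _
  have hunc : ¬ (D.carrier).Countable := fun hc =>
    (IsOpen.measure_ne_zero (μ := MeasureTheory.volume) D.isOpen D.nonempty) (hc.measure_zero _)
  obtain ⟨z₀, hz₀D, hz₀C⟩ : ∃ z₀ ∈ D.carrier, z₀ ∉ C := by
    by_contra hne
    push Not at hne
    exact hunc (hCc.mono fun w hw => hne w hw)
  -- the modified potential limit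
  set G' : ℂ → ℂ := Function.update G z₀ (G z₀ + 1) with hG'
  have hG'lim : IsPotentialLimit D Λ u G' := isPotentialLimit_congr_off_centres hG fun k f => by
    rw [hG', Function.update_of_ne]
    exact fun heq => hz₀C (mem_iUnion.2 ⟨k, f, heq⟩)
  have cont : ∀ F : ℂ → ℂ, (DifferentiableOn ℂ F D.carrier ∨
      DifferentiableOn ℂ (fun z => (starRingEnd ℂ) (F z)) D.carrier) → ContinuousAt F z₀ := by
    rintro F (hF | hF)
    · exact (hF.continuousOn.continuousWithinAt hz₀D).continuousAt (D.isOpen.mem_nhds hz₀D)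
    · have h1 : ContinuousAt (fun z => (starRingEnd ℂ) (F z)) z₀ :=
        (hF.continuousOn.continuousWithinAt hz₀D).continuousAt (D.isOpen.mem_nhds hz₀D)
      have h2 := Complex.continuous_conj.continuousAt.comp h1
      have e : ((⇑(starRingEnd ℂ)) ∘ fun z => (starRingEnd ℂ) (F z)) = F := funext fun z => by simp
      rwa [e] at h2
  have hc1 := cont G (h D hD Λ hΛ u hu hu0 G hG)
  have hc2 := cont G' (h D hD Λ hΛ u hu hu0 G' hG'lim)
  -- `G' − G` is continuous at `z₀`, vanishes on the punctured neighbourhood, and equals `1` at `z₀`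
  have hdiff : ContinuousAt (fun w => G' w - G w) z₀ := hc2.sub hc1
  have hval : (fun w => G' w - G w) z₀ = 1 := by simp [hG']
  have hzero : ∀ w, w ≠ z₀ → G' w - G w = 0 := fun w hw => by simp [hG', Function.update_of_ne hw]
  have hlim : Tendsto (fun w => G' w - G w) (𝓝[≠] z₀) (𝓝 1) := by
    rw [← hval]; exact hdiff.continuousWithinAt.tendsto
  have hlim0 : Tendsto (fun w => G' w - G w) (𝓝[≠] z₀) (𝓝 0) :=
    tendsto_const_nhds.congr' (eventually_nhdsWithin_of_forall fun w hw => (hzero w hw).symm)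
  have := tendsto_nhds_unique hlim hlim0
  exact one_ne_zero this

end Summit.CriticalPhenomena.CardyFormulaZ2.Cruxes.ParafermionToSLESixFamilies.PotentialDarbouxPicardDiamond

end
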